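import Mathlib
import Summits.NavierStokesRegularity.NavierStokesRegularity.Theorems.ThreadingFluxHorizonTowerQuadraticGeneratorConfinement
import Summits.NavierStokesRegularity.NavierStokesRegularity.Theorems.ThreadingFluxHorizonTowerFourthDigitCompetitor
import Summits.NavierStokesRegularity.NavierStokesRegularity.Theorems.ThreadingFluxHorizonTowerFourthDigitK22
import HarnessLib

/-!
# Crux `PoloidalLiouville` (stmt-NavierStokesRegularity-1222), crux idea «horizon-threading-tower» (ns-idea-15):
# THE FOURTH CONE DIGIT, V — the exit: from the second digit's identity to `W = 0`

Support file (`--supports stmt-NavierStokesRegularity-1222`, helper; cell `ns-wall-extremal`, width hand ns-wall-eng-3 g7; 0 kit), toward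
THM K (`FiniteTowerGcdTwoTwoShellsHorizonTowerZonality`; kernel file `…FiniteTowerGcdTwoTwoShells`, split for the 400-line cap).

★★ `fourthDigit_genW_eq_zero`: the DIGIT-3 CONFINEMENT WITH SOURCE and the FOURTH DIGIT, packaged.  Input = exactly the state of THM J's
proof after its digit 2 (`…FiniteTowerGcdTwoCompetitor`, steps (0)–(4)), in general degree `m = k + 2 ≥ 2`: the second-digit identity (E2)
of a tower with top pair `P_{D′} = g₁L^{k+4} + ρG₁`, `P_D = g₂L^{n+2} + ρG₂`, confined competitor `u·P_c = κ₀L^{k+3} + κ₁L^{k+2}M + ρG_c`,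
free shells `P_b` (degree `D′−4`, harmonic), `P₆` (degree `D′−6`, absent when `k ≥ 2`), the level-`N−6` coefficients `e₁ e₂ e₃`, the
remainder relations, THM J's third-digit scalars `K_M, Z_W, z_b` (with `K_M`'s closed form) and its digit-3 identity
`K_M·L^{k+n+3}MW + Z_W·L^{k+n+4}W + z_b·L^{n+3}{P_b, L} ≡ 0 (mod ρ)`.  Output: `W = det(x,Qx,Q²x) = 0`.
PROOF. (6) The chart of the digit-3 identity makes `chartT{8z_b·P_b − K_M·L^kM² − 2Z_W·L^{k+1}M, L} = 0`, so by CONFINEMENT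
(`…QuadraticGeneratorConfinement`) `8z_b·P_b = K_M·L^kM² + 2Z_W·L^{k+1}M + γL^{k+2} + ρG_b`: THM J's obstruction `K_M` survives as
the LEADING COEFFICIENT of the free shell.  (7) Every bracket of (E2) to SECOND order in `ρ` (`…FourthDigit`, `…FourthDigitBrackets`,
`…FourthDigitCompetitor`), the `P_b` channels through `P_b′ = 8z_b·P_b`, the `D′−6` channel absorbed for `k ≤ 1`, the `e`-terms on the
`L`-slots; the `ρ⁰` part cancels identically (that is digit 3) and the `ρ¹` part reads
`K₂₂·L^{k+n+3}M²W + L^{k+n+4}·(Z₁MW + Z₂LW + z₆Z₆) ≡ 0 (mod ρ)` with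
`K₂₂ = 679477248·(4m+7)³(4m+3)(4m+5)·c₁·g₂(n+2)·z_b·g₁g₂·c₀(m−n)(m+2)(n+2)·N₄(m,n) ≠ 0` (`…FourthDigitK22`, `…FourthDigitNumerator`).
(8) On the null cone `chartT L ∣ K₂₂·chartT W·(chartT M)²`, impossible off the uniaxial locus (`eq_zero_of_chartT_genL_dvd_sq`).
Every coefficient above was first computed by the seat's exact reduced-algebra CAS and checked against full harmonic projections.

HONEST LABEL: polynomial algebra about one crux idea's typed objects; no Prop of the sketch is closed here; `HorizonTowerZonality`
(general towers), `PoloidalLiouville` (1222) OPEN; NS regularity NOT proved.  [folklore]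
-/

-- the summit and its single sub-problem share the name (CONVENTIONS §1)
set_option linter.dupNamespace false
-- `simp only` closers over `C`-coefficients are import-order sensitive (simprocs); keep the lists explicit, silence the arg linter
set_option linter.unusedSimpArgs false

noncomputable section

open MvPolynomial Complex
open scoped Polynomial RealInnerProductSpace

namespace Summit.NavierStokesRegularity.NavierStokesRegularity.Theorems.PoloidalLiouville.HorizonTower

section Exit

variable (ra rb rd re rf : ℝ)

set_option maxHeartbeats 8000000 in
set_option maxRecDepth 200000 in
/-- ★★ **THE FOURTH CONE DIGIT (confinement with source, then exit).**  See the file docstring for the meaning of each binder.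
[folklore] -/
theorem fourthDigit_genW_eq_zero {k n : ℕ} (hmn : k + 2 < n)
    {PD PD' Pc Pb P6 T6 R G₁ G₂ Gc J J₆ : Zonal.RPoly} {g₁ g₂ κ₀ κ₁ u c₀ c₁ cb c₆ e₁ e₂ e₃ Ze KM zW zb : ℝ}
    (hL0 : Zonal.genL ra rb rd re rf ≠ 0) (hLc : Zonal.chartT (map (algebraMap ℝ ℂ) (Zonal.genL ra rb rd re rf)) ≠ 0)
    (hg₁0 : g₁ ≠ 0) (hg₂0 : g₂ ≠ 0) (hc₀0 : c₀ ≠ 0) (hc₁0 : c₁ ≠ 0) (hcb0 : cb ≠ 0) (hu0 : u ≠ 0)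
    (hPDeq : PD = C g₂ * Zonal.genL ra rb rd re rf ^ (n + 2) + Zonal.normSq * G₂)
    (hPD'eq : PD' = C g₁ * Zonal.genL ra rb rd re rf ^ ((k + 2) + 2) + Zonal.normSq * G₁)
    (hG₁' : G₁.IsHomogeneous (2 * (k + 2) + 2)) (hG₂' : G₂.IsHomogeneous (2 * n + 2))
    (hr₁' : C (8 * ((k + 2 : ℕ) : ℝ) + 14) * G₁ = C (-(4 * (((k + 2 : ℕ) : ℝ) + 2) * (((k + 2 : ℕ) : ℝ) + 1) * g₁))
      * Zonal.genL ra rb rd re rf ^ (k + 2) * Zonal.genM ra rb rd re rf - Zonal.normSq * Zonal.lapP G₁)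
    (hr₂' : C (8 * (n : ℝ) + 14) * G₂ = C (-(4 * ((n : ℝ) + 2) * ((n : ℝ) + 1) * g₂))
      * Zonal.genL ra rb rd re rf ^ n * Zonal.genM ra rb rd re rf - Zonal.normSq * Zonal.lapP G₂)
    (hGc' : Gc.IsHomogeneous (2 * (k + 2)))
    (hPc'eq : C u * Pc = C κ₀ * Zonal.genL ra rb rd re rf ^ ((k + 2) + 1) + C κ₁ * Zonal.genL ra rb rd re rf ^ (k + 2) * Zonal.genM ra rb rd re rf
      + Zonal.normSq * Gc)
    (hPc'l : Zonal.lapP (C u * Pc) = 0)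
    (hPbh : Pb.IsHomogeneous (2 * (k + 2))) (hPbl : Zonal.lapP Pb = 0) (hP6z : 2 ≤ k → P6 = 0)
    (he₂ : n ≠ k + 3 → e₂ = 0) (he₃ : n ≠ k + 4 → e₃ = 0)
    (heZ : C e₁ * Zonal.genL ra rb rd re rf ^ (2 * (k + 2) + 3) = C Ze * Zonal.genL ra rb rd re rf ^ ((k + 2) + n + 2))
    (hT6 : T6 = C c₆ * Zonal.detP P6 PD + C e₂ * Zonal.detP Pb PD' + C e₃ * Zonal.detP Pc PD')
    (hu : u = c₁ * ((8 * ((k + 2 : ℕ) : ℝ) + 14) * (8 * (n : ℝ) + 14)) * (g₂ * ((n : ℝ) + 2)))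
    (hκ₁ : κ₁ = 24 * c₀ * (((k + 2 : ℕ) : ℝ) + 2) * ((n : ℝ) + 2) * (((k + 2 : ℕ) : ℝ) - n) * g₁ * g₂)
    (hKM : KM = u * (8 * (n : ℝ) + 14) * (16 * ((k + 2 : ℕ) : ℝ) + 20) * (16 * (n : ℝ) + 20) * (32 * ((k + 2 : ℕ) : ℝ) * (((k + 2 : ℕ) : ℝ) - 1) * κ₁)
      + c₁ * ((8 * ((k + 2 : ℕ) : ℝ) + 14) * (8 * (n : ℝ) + 14)) * (8 * ((k + 2 : ℕ) : ℝ) + 6) * (16 * ((k + 2 : ℕ) : ℝ) + 20) * (16 * (n : ℝ) + 20)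
        * (4 * (((k + 2 : ℕ) : ℝ) - n) * κ₁ * (-(4 * ((n : ℝ) + 2) * ((n : ℝ) + 1) * g₂)))
      + c₀ * u * (8 * (n : ℝ) + 14) * (8 * ((k + 2 : ℕ) : ℝ) + 6)
        * (-((8 * ((k + 2 : ℕ) : ℝ) + 14) * (((k + 2 : ℕ) : ℝ) + 2) * g₁) * (16 * ((k + 2 : ℕ) : ℝ) + 20)
            * (32 * (-(4 * ((n : ℝ) + 2) * ((n : ℝ) + 1) * g₂)) * (n : ℝ) * ((n : ℝ) - 1))
          + ((8 * (n : ℝ) + 14) * ((n : ℝ) + 2) * g₂) * (16 * (n : ℝ) + 20)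
            * (32 * (-(4 * (((k + 2 : ℕ) : ℝ) + 2) * (((k + 2 : ℕ) : ℝ) + 1) * g₁)) * ((k + 2 : ℕ) : ℝ) * (((k + 2 : ℕ) : ℝ) - 1))
          + (16 * ((k + 2 : ℕ) : ℝ) + 20) * (16 * (n : ℝ) + 20)
            * (4 * (((k + 2 : ℕ) : ℝ) - n) * (-(4 * (((k + 2 : ℕ) : ℝ) + 2) * (((k + 2 : ℕ) : ℝ) + 1) * g₁)) * (-(4 * ((n : ℝ) + 2) * ((n : ℝ) + 1) * g₂)))))
    (hzW : zW = u * (8 * (n : ℝ) + 14) * (16 * ((k + 2 : ℕ) : ℝ) + 20) * (16 * (n : ℝ) + 20) * (16 * (((k + 2 : ℕ) : ℝ) + 1) * ((k + 2 : ℕ) : ℝ) * κ₀)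
      + c₁ * ((8 * ((k + 2 : ℕ) : ℝ) + 14) * (8 * (n : ℝ) + 14)) * (8 * ((k + 2 : ℕ) : ℝ) + 6) * (16 * ((k + 2 : ℕ) : ℝ) + 20) * (16 * (n : ℝ) + 20)
        * (4 * (((k + 2 : ℕ) : ℝ) + 1) * κ₀ * (-(4 * ((n : ℝ) + 2) * ((n : ℝ) + 1) * g₂)))
      - ((8 * ((k + 2 : ℕ) : ℝ) + 14) * (8 * (n : ℝ) + 14)) * Ze * (8 * (n : ℝ) + 14) * (8 * ((k + 2 : ℕ) : ℝ) + 6) * (16 * ((k + 2 : ℕ) : ℝ) + 20)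
        * (16 * (n : ℝ) + 20) * (4 * (((k + 2 : ℕ) : ℝ) + 2) * κ₁ * g₁))
    (hzb : zb = ((8 * ((k + 2 : ℕ) : ℝ) + 14) * (8 * (n : ℝ) + 14)) * cb * u * (8 * (n : ℝ) + 14) * (8 * ((k + 2 : ℕ) : ℝ) + 6)
      * (16 * ((k + 2 : ℕ) : ℝ) + 20) * (16 * (n : ℝ) + 20) * (g₂ * ((n : ℝ) + 2)))
    (hT5 : C u * Zonal.detP Pc PD' = -(C (4 * (((k + 2 : ℕ) : ℝ) + 2) * κ₁ * g₁) * Zonal.genL ra rb rd re rf ^ (2 * (k + 2) + 1) * Zonal.genW ra rb rd re rf) + Zonal.normSq * J₆)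
    (hJ : C KM * Zonal.genL ra rb rd re rf ^ ((k + 2) + n + 1) * Zonal.genM ra rb rd re rf * Zonal.genW ra rb rd re rf + C zW * Zonal.genL ra rb rd re rf ^ ((k + 2) + n + 2) * Zonal.genW ra rb rd re rf + C zb * Zonal.genL ra rb rd re rf ^ (n + 3) * Zonal.detP Pb (Zonal.genL ra rb rd re rf) + Zonal.normSq * J = 0)
    (hE2 : Zonal.genL ra rb rd re rf ^ (n + 1) * Zonal.detP Gc (Zonal.genL ra rb rd re rf) + (C (c₁ * ((8 * ((k + 2 : ℕ) : ℝ) + 14) * (8 * (n : ℝ) + 14))) * Zonal.detP Pc G₂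
      + (C c₀ * (-(C ((8 * ((k + 2 : ℕ) : ℝ) + 14) * (((k + 2 : ℕ) : ℝ) + 2) * g₁) * Zonal.genL ra rb rd re rf ^ ((k + 2) + 1) * Zonal.detP (Zonal.genL ra rb rd re rf) (Zonal.lapP G₂))
          + C ((8 * (n : ℝ) + 14) * ((n : ℝ) + 2) * g₂) * Zonal.genL ra rb rd re rf ^ (n + 1) * Zonal.detP (Zonal.genL ra rb rd re rf) (Zonal.lapP G₁)
          + C ((8 * ((k + 2 : ℕ) : ℝ) + 14) * (8 * (n : ℝ) + 14)) * Zonal.detP G₁ G₂)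
        + C ((8 * ((k + 2 : ℕ) : ℝ) + 14) * (8 * (n : ℝ) + 14)) * (C cb * Zonal.detP Pb PD + C e₁ * Zonal.detP Pc PD')
        + Zonal.normSq * (C ((8 * ((k + 2 : ℕ) : ℝ) + 14) * (8 * (n : ℝ) + 14)) * T6) + Zonal.normSq ^ 2 * (C ((8 * ((k + 2 : ℕ) : ℝ) + 14) * (8 * (n : ℝ) + 14)) * R))) = 0) :
    Zonal.genW ra rb rd re rf = 0 := by
  set L := Zonal.genL ra rb rd re rf with hLdef
  set M := Zonal.genM ra rb rd re rf with hMdef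
  set W := Zonal.genW ra rb rd re rf with hWdef
  have hdet0 : ∀ Q : Zonal.RPoly, Zonal.detP 0 Q = 0 := fun Q => by rw [← C_0, Zonal.detP_C_left, C_0]
  have hKM' := congrArg (fun x : ℝ => (C x : Zonal.RPoly)) hKM
  have hzW' := congrArg (fun x : ℝ => (C x : Zonal.RPoly)) hzW
  simp only [map_mul, map_add, map_sub, map_neg, map_natCast, map_ofNat, map_one] at hKM' hzW'
  -- (6) the chart of the third digit CONFINES the `D′ − 4` shell: `8z_b·P_b = K_M·L^kM² + 2z_W·L^(k+1)M + γL^(k+2) + ρG_b`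
  have h1 := congrArg (fun p : Zonal.RPoly => Zonal.chartT (map (algebraMap ℝ ℂ) p)) hJ
  simp only [map_add, map_mul, map_pow, Zonal.map_normSq, Zonal.chartT_add, Zonal.chartT_mul, Zonal.chartT_pow, Zonal.chartT_normSq,
    zero_mul, add_zero, map_zero, Zonal.chartT_zero, map_C, Zonal.chartT_C] at h1
  set Xb : Zonal.RPoly := C (8 * zb) * Pb - C KM * (L ^ k * M ^ 2) - C (2 * zW) * (L ^ (k + 1) * M) with hXb
  have hXbh : Xb.IsHomogeneous (2 * (k + 2)) := by
    refine ((hPbh.C_mul _).sub ?_).sub ?_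
    · have h := (((Zonal.isHomogeneous_genL ra rb rd re rf).pow k).mul ((Zonal.isHomogeneous_genM ra rb rd re rf).pow 2)).C_mul KM
      rw [show 2 * k + 2 * 2 = 2 * (k + 2) by ring] at h
      simpa [mul_assoc] using h
    · have h := (((Zonal.isHomogeneous_genL ra rb rd re rf).pow (k + 1)).mul (Zonal.isHomogeneous_genM ra rb rd re rf)).C_mul (2 * zW)
      rw [show 2 * (k + 1) + 2 = 2 * (k + 2) by ring] at h
      simpa [mul_assoc] using h
  have hXbL : Zonal.detP Xb L = C (8 * zb) * Zonal.detP Pb L + C (8 * KM) * L ^ k * M * W + C (8 * zW) * L ^ (k + 1) * W := by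
    have e1 : Zonal.detP (L ^ k * M ^ 2) L = -(C 8 * L ^ k * M * W) := by
      rw [Zonal.detP_mul_left, hLdef, hMdef, hWdef, Zonal.detP_genM_sq_genL, Zonal.detP_genL_pow_genL, mul_zero, add_zero]
      simp only [map_ofNat]; ring
    have e2 : Zonal.detP (L ^ (k + 1) * M) L = -(C 4 * L ^ (k + 1) * W) := by
      rw [hLdef, hMdef, hWdef]; exact Zonal.detP_genL_pow_mul_genM_genL ra rb rd re rf (k + 1)
    rw [hXb, Zonal.detP_sub_left, Zonal.detP_sub_left, Zonal.detP_C_mul_left, Zonal.detP_C_mul_left, Zonal.detP_C_mul_left, e1, e2]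
    simp only [map_mul, map_ofNat]; ring
  have h2 : Zonal.chartT (map (algebraMap ℝ ℂ) L) ^ (n + 3) * Zonal.chartT (map (algebraMap ℝ ℂ) (Zonal.detP Xb L)) = 0 := by
    rw [hXbL]
    simp only [map_add, map_mul, map_pow, map_C, Zonal.chartT_add, Zonal.chartT_mul, Zonal.chartT_pow, Zonal.chartT_C]
    simp only [map_ofNat]
    linear_combination (8 : ℂ[X]) * h1
  have hXbchart : Zonal.chartT (map (algebraMap ℝ ℂ) (Zonal.detP Xb L)) = 0 :=
    (mul_eq_zero.mp h2).resolve_left (pow_ne_zero _ hLc)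
  obtain ⟨γ, Gb, hGb, hXbeq⟩ := Zonal.exists_eq_C_mul_pow_add_of_chartT_detP_genL hXbh (by omega) hL0
    (by rw [hLdef] at hXbchart; exact hXbchart)
  have hGb' : Gb.IsHomogeneous (2 * k + 2) := by rw [show 2 * k + 2 = 2 * (k + 2) - 2 by omega]; exact hGb
  set Pb' : Zonal.RPoly := C (8 * zb) * Pb with hPb'
  have hPb'eq : Pb' = C KM * L ^ k * M ^ 2 + C (2 * zW) * L ^ (k + 1) * M + C γ * L ^ (k + 2) + Zonal.normSq * Gb := by
    rw [hPb', show C (8 * zb) * Pb = Xb + C KM * (L ^ k * M ^ 2) + C (2 * zW) * (L ^ (k + 1) * M) by rw [hXb]; ring, hXbeq]; ring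
  have hPb'l : Zonal.lapP Pb' = 0 := by rw [hPb', Zonal.lapP_C_mul, hPbl, mul_zero]
  -- (7) DIGIT 4: every bracket of (E2) to SECOND order (`…FourthDigitBrackets/Competitor`), the `D′ − 4` shell through `P_b′`
  have hGck : Gc.IsHomogeneous (2 * k + 4) := by rw [show 2 * k + 4 = 2 * (k + 2) by ring]; exact hGc'
  have hPc'eqk : C u * Pc = C κ₀ * L ^ (k + 3) + C κ₁ * L ^ (k + 2) * M + Zonal.normSq * Gc := by linear_combination hPc'eq
  have hPD'eqk : PD' = C g₁ * L ^ (k + 4) + Zonal.normSq * G₁ := by linear_combination hPD'eq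
  have hr₁'k : C (8 * (k : ℝ) + 30) * G₁ = C (-(4 * (((k + 2 : ℕ) : ℝ) + 2) * (((k + 2 : ℕ) : ℝ) + 1) * g₁)) * L ^ (k + 2) * M
      - Zonal.normSq * Zonal.lapP G₁ := by
    rw [show (8 * (k : ℝ) + 30) = 8 * ((k + 2 : ℕ) : ℝ) + 14 by push_cast; ring]; exact hr₁'
  obtain ⟨I₁, hX3⟩ := Zonal.exists_detP_genL_competitorRemainder₂ ra rb rd re rf hGck hPc'eqk hPc'l
  obtain ⟨I₂, hX4⟩ := Zonal.exists_detP_competitor_remainder₂ ra rb rd re rf hGck hG₂' hPc'eqk hPc'l hr₂'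
  obtain ⟨I₃, hX1b⟩ := Zonal.exists_detP_genL_lapP_remainder₂ ra rb rd re rf (j := n) (by omega) hG₂' hr₂'
  obtain ⟨I₄, hX1a⟩ := Zonal.exists_detP_genL_lapP_remainder₂ ra rb rd re rf (j := k + 2) (by omega) hG₁' hr₁'
  obtain ⟨I₅, hX2⟩ := Zonal.exists_detP_remainders₂ ra rb rd re rf hG₁' hG₂' hr₁' hr₂'
  obtain ⟨I₆, hX6a⟩ := Zonal.exists_detP_genL_bShellRemainder ra rb rd re rf hGb' hPb'eq hPb'l
  obtain ⟨I₇, hX6b⟩ := Zonal.exists_detP_bShell_remainder ra rb rd re rf hPb'eq hr₂'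
  obtain ⟨I₈, hX5⟩ := Zonal.exists_detP_competitor_top₂ ra rb rd re rf hGck hPc'eqk hPc'l hPD'eqk hr₁'k
  simp only [← hLdef, ← hMdef, ← hWdef] at hX3 hX4 hX1b hX1a hX2 hX6a hX6b hX5
  rw [Zonal.detP_C_mul_left] at hX4 hX5
  -- the `P_b′` channels and the `D′ − 6` shell
  have hPbB : ∀ Y : Zonal.RPoly, Zonal.detP Pb' Y = C (8 * zb) * Zonal.detP Pb Y := fun Y => by rw [hPb', Zonal.detP_C_mul_left]
  have hPbD2 : C (8 * zb) * Zonal.detP Pb PD = C (g₂ * ((n : ℝ) + 2)) * L ^ (n + 1) * Zonal.detP Pb' L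
      + Zonal.normSq * Zonal.detP Pb' G₂ := by
    rw [← hPbB]; have h := Zonal.detP_genShell_right ra rb rd re rf Pb' hPDeq; simp only [← hLdef] at h; exact h
  have hPbD3 : C (8 * zb) * Zonal.detP Pb PD' = C (g₁ * (((k + 2 : ℕ) : ℝ) + 2)) * L ^ ((k + 2) + 1) * Zonal.detP Pb' L
      + Zonal.normSq * Zonal.detP Pb' G₁ := by
    rw [← hPbB]; have h := Zonal.detP_genShell_right ra rb rd re rf Pb' hPD'eq; simp only [← hLdef] at h; exact h
  have hPbL : Zonal.detP Pb' L = -(C (8 * KM) * L ^ k * M * W) - C (4 * (2 * zW)) * L ^ (k + 1) * W + Zonal.normSq * Zonal.detP Gb L := by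
    rw [hPb'eq, Zonal.detP_add_left, hLdef, hMdef, hWdef, Zonal.detP_bShell_genL, Zonal.detP_normSq_mul_genL]
  have hP6D : Zonal.detP P6 PD = C (g₂ * ((n : ℝ) + 2)) * L ^ (n + 1) * Zonal.detP P6 L + Zonal.normSq * Zonal.detP P6 G₂ := by
    have h := Zonal.detP_genShell_right ra rb rd re rf P6 hPDeq; simp only [← hLdef] at h; exact h
  -- the `D′ − 6` shell is absorbed when `k ≤ 1` and absent when `k ≥ 2`
  obtain ⟨Z6, hZ6⟩ : ∃ Z6 : Zonal.RPoly, L ^ (n + 5) * Zonal.detP P6 L = L ^ (k + n + 4) * Z6 := by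
    rcases Nat.lt_or_ge k 2 with hk2 | hk2
    · interval_cases k
      · exact ⟨L * Zonal.detP P6 L, by ring⟩
      · exact ⟨Zonal.detP P6 L, by ring⟩
    · refine ⟨0, ?_⟩
      rw [hP6z hk2, hdet0]; ring
  -- the `e`-terms sit on the `L`-slots (`e₁ = e₂ = 0` unless `n = k + 3`, `e₃ = 0` unless `n = k + 4`)
  obtain ⟨Ze₂, heZ₂⟩ : ∃ Ze₂ : ℝ, C e₂ * L ^ (2 * k + 7) = C Ze₂ * L ^ (k + n + 4) := by
    by_cases hnk : n = k + 3
    · exact ⟨e₂, by rw [show 2 * k + 7 = k + n + 4 by omega]⟩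
    · refine ⟨0, ?_⟩
      rw [he₂ hnk, map_zero, zero_mul, zero_mul]
  obtain ⟨Ze₃, heZ₃⟩ : ∃ Ze₃ : ℝ, C e₃ * L ^ (2 * k + 9) = C Ze₃ * L ^ (k + n + 5) := by
    by_cases hnk : n = k + 4
    · exact ⟨e₃, by rw [show 2 * k + 9 = k + n + 5 by omega]⟩
    · refine ⟨0, ?_⟩
      rw [he₃ hnk, map_zero, zero_mul, zero_mul]
  have heZ₁ : C e₁ * L ^ (2 * k + 7) = C Ze * L ^ (k + n + 4) := by
    rw [show 2 * k + 7 = 2 * (k + 2) + 3 by ring, show k + n + 4 = (k + 2) + n + 2 by ring]; exact heZ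
  -- the digit-4 coefficients (`τ = tr Q²` enters the `L²`-slot)
  obtain ⟨τr, hτr⟩ : ∃ τr : ℝ, τr = Zonal.genTau ra rb rd re rf := ⟨_, rfl⟩
  obtain ⟨K22, hK22⟩ : ∃ K22 : ℝ, K22 =
      (u * (8 * zb) * (8 * ((k : ℝ) + 2) + 14) * (8 * (n : ℝ) + 14) * (16 * ((k : ℝ) + 2) + 20) * (16 * (n : ℝ) + 20) * (24 * ((k : ℝ) + 2) + 18) *
      (24 * (n : ℝ) + 18) * (8 * (k : ℝ) + 14)) * (-(192 * ((k : ℝ) + 2) * ((k : ℝ) + 1) * (k : ℝ) * ((k : ℝ) - 1) * κ₁)) + c₁ * ((8 * ((k : ℝ) + 2)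
      + 14) * (8 * (n : ℝ) + 14)) * ((8 * zb) * (8 * ((k : ℝ) + 2) + 14) * (16 * (k : ℝ) + 36) * (16 * ((k : ℝ) + 2) + 20) * (24 * ((k : ℝ) + 2) +
      18) * (24 * (n : ℝ) + 18) * (8 * (k : ℝ) + 14)) * (-(16 * (n : ℝ) * ((n : ℝ) - 1) * (2 * (k : ℝ) - (n : ℝ) + 6) * (8 * (k : ℝ) + 22) * (-(4 *
      ((n : ℝ) + 2) * ((n : ℝ) + 1) * g₂)) * κ₁ - 16 * ((k : ℝ) + 2) * ((k : ℝ) + 1) * (2 * (n : ℝ) - (k : ℝ)) * (16 * (n : ℝ) + 20) * (-(4 * ((n :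
      ℝ) + 2) * ((n : ℝ) + 1) * g₂)) * κ₁)) + 192 * c₀ * (8 * ((k : ℝ) + 2) + 14) * ((k : ℝ) + 4) * g₁ * (n : ℝ) * ((n : ℝ) - 1) * ((n : ℝ) - 2) *
      ((n : ℝ) - 3) * (-(4 * ((n : ℝ) + 2) * ((n : ℝ) + 1) * g₂)) * (u * (8 * zb) * (8 * ((k : ℝ) + 2) + 14) * (8 * (n : ℝ) + 14) * (8 * (k : ℝ) +
      22) * (16 * (k : ℝ) + 36) * (16 * ((k : ℝ) + 2) + 20) * (24 * ((k : ℝ) + 2) + 18) * (8 * (k : ℝ) + 14)) - 192 * c₀ * (8 * (n : ℝ) + 14) * ((n :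
      ℝ) + 2) * g₂ * ((k : ℝ) + 2) * ((k : ℝ) + 1) * (k : ℝ) * ((k : ℝ) - 1) * (-(4 * (((k : ℝ) + 2) + 2) * (((k : ℝ) + 2) + 1) * g₁)) * (u * (8 *
      zb) * (8 * ((k : ℝ) + 2) + 14) * (8 * (n : ℝ) + 14) * (8 * (k : ℝ) + 22) * (16 * (k : ℝ) + 36) * (16 * (n : ℝ) + 20) * (24 * (n : ℝ) + 18) * (8
      * (k : ℝ) + 14)) - c₀ * ((8 * ((k : ℝ) + 2) + 14) * (8 * (n : ℝ) + 14)) * (u * (8 * zb) * (8 * (k : ℝ) + 22) * (16 * (k : ℝ) + 36) * (24 * ((k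
      : ℝ) + 2) + 18) * (24 * (n : ℝ) + 18) * (8 * (k : ℝ) + 14)) * (-(4 * (((k : ℝ) + 2) + 2) * (((k : ℝ) + 2) + 1) * g₁)) * (-(4 * ((n : ℝ) + 2) *
      ((n : ℝ) + 1) * g₂)) * (16 * (n : ℝ) * ((n : ℝ) - 1) * (2 * (k : ℝ) - (n : ℝ) + 6) * (16 * ((k : ℝ) + 2) + 20) - 16 * ((k : ℝ) + 2) * ((k : ℝ)
      + 1) * (2 * (n : ℝ) - (k : ℝ)) * (16 * (n : ℝ) + 20)) + (((8 * ((k : ℝ) + 2) + 14) * (8 * (n : ℝ) + 14)) * cb * u * (8 * ((k : ℝ) + 2) + 14) *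
      (8 * (n : ℝ) + 14) * (8 * (k : ℝ) + 22) * (16 * (k : ℝ) + 36) * (16 * ((k : ℝ) + 2) + 20) * (16 * (n : ℝ) + 20) * (24 * ((k : ℝ) + 2) + 18) *
      (24 * (n : ℝ) + 18) * (g₂ * ((n : ℝ) + 2))) * (48 * (k : ℝ) * ((k : ℝ) - 1) * KM) + (((8 * ((k : ℝ) + 2) + 14) * (8 * (n : ℝ) + 14)) * cb * u *
      (8 * ((k : ℝ) + 2) + 14) * (8 * (k : ℝ) + 22) * (16 * (k : ℝ) + 36) * (16 * ((k : ℝ) + 2) + 20) * (16 * (n : ℝ) + 20) * (24 * ((k : ℝ) + 2) +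
      18) * (24 * (n : ℝ) + 18) * (8 * (k : ℝ) + 14)) * (-(4 * ((n : ℝ) + 2) * ((n : ℝ) + 1) * g₂)) * (4 * ((k : ℝ) - 2 * (n : ℝ)) * KM) := ⟨_, rfl⟩
  obtain ⟨Z1, hZ1⟩ : ∃ Z1 : ℝ, Z1 =
      (u * (8 * zb) * (8 * ((k : ℝ) + 2) + 14) * (8 * (n : ℝ) + 14) * (16 * ((k : ℝ) + 2) + 20) * (16 * (n : ℝ) + 20) * (24 * ((k : ℝ) + 2) + 18) *
      (24 * (n : ℝ) + 18) * (8 * (k : ℝ) + 14)) * (-(128 * ((k : ℝ) + 3) * ((k : ℝ) + 2) * ((k : ℝ) + 1) * (k : ℝ) * κ₀)) + c₁ * ((8 * ((k : ℝ) + 2)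
      + 14) * (8 * (n : ℝ) + 14)) * ((8 * zb) * (8 * ((k : ℝ) + 2) + 14) * (16 * (k : ℝ) + 36) * (16 * ((k : ℝ) + 2) + 20) * (24 * ((k : ℝ) + 2) +
      18) * (24 * (n : ℝ) + 18) * (8 * (k : ℝ) + 14)) * (-(32 * (n : ℝ) * ((n : ℝ) - 1) * ((k : ℝ) + 3) * (8 * (k : ℝ) + 22) * (-(4 * ((n : ℝ) + 2) *
      ((n : ℝ) + 1) * g₂)) * κ₀) - 16 * ((k : ℝ) + 3) * ((k : ℝ) + 2) * ((k : ℝ) + 1 - (n : ℝ)) * (16 * (n : ℝ) + 20) * (-(4 * ((n : ℝ) + 2) * ((n :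
      ℝ) + 1) * g₂)) * κ₀) + (((8 * ((k : ℝ) + 2) + 14) * (8 * (n : ℝ) + 14)) * cb * u * (8 * ((k : ℝ) + 2) + 14) * (8 * (n : ℝ) + 14) * (8 * (k : ℝ)
      + 22) * (16 * (k : ℝ) + 36) * (16 * ((k : ℝ) + 2) + 20) * (16 * (n : ℝ) + 20) * (24 * ((k : ℝ) + 2) + 18) * (24 * (n : ℝ) + 18) * (g₂ * ((n :
      ℝ) + 2))) * (64 * (k : ℝ) * ((k : ℝ) + 1) * zW) + (((8 * ((k : ℝ) + 2) + 14) * (8 * (n : ℝ) + 14)) * cb * u * (8 * ((k : ℝ) + 2) + 14) * (8 *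
      (k : ℝ) + 22) * (16 * (k : ℝ) + 36) * (16 * ((k : ℝ) + 2) + 20) * (16 * (n : ℝ) + 20) * (24 * ((k : ℝ) + 2) + 18) * (24 * (n : ℝ) + 18) * (8 *
      (k : ℝ) + 14)) * (-(4 * ((n : ℝ) + 2) * ((n : ℝ) + 1) * g₂)) * (8 * ((k : ℝ) + 1 - (n : ℝ)) * zW) + (((8 * ((k : ℝ) + 2) + 14) * (8 * (n : ℝ) +
      14)) * (8 * zb) * (8 * (n : ℝ) + 14) * (16 * (k : ℝ) + 36) * (16 * ((k : ℝ) + 2) + 20) * (16 * (n : ℝ) + 20) * (24 * ((k : ℝ) + 2) + 18) * (24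
      * (n : ℝ) + 18) * (8 * (k : ℝ) + 14)) * Ze * (32 * ((k : ℝ) + 4) * ((k : ℝ) + 2) * ((k : ℝ) + 1) * (8 * ((k : ℝ) + 2) + 14) * g₁ * κ₁) - 8 *
      ((8 * ((k : ℝ) + 2) + 14) * (8 * (n : ℝ) + 14)) * u * ((8 * ((k : ℝ) + 2) + 14) * (8 * (n : ℝ) + 14) * (8 * (k : ℝ) + 22) * (16 * (k : ℝ) + 36)
      * (16 * ((k : ℝ) + 2) + 20) * (16 * (n : ℝ) + 20) * (24 * ((k : ℝ) + 2) + 18) * (24 * (n : ℝ) + 18) * (8 * (k : ℝ) + 14)) * g₁ * ((k : ℝ) + 4)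
      * KM * Ze₂ := ⟨_, rfl⟩
  obtain ⟨Z2, hZ2⟩ : ∃ Z2 : ℝ, Z2 =
      (u * (8 * zb) * (8 * ((k : ℝ) + 2) + 14) * (8 * (n : ℝ) + 14) * (16 * ((k : ℝ) + 2) + 20) * (16 * (n : ℝ) + 20) * (24 * ((k : ℝ) + 2) + 18) *
      (24 * (n : ℝ) + 18) * (8 * (k : ℝ) + 14)) * (-(96 * ((k : ℝ) + 2) * ((k : ℝ) + 1) * (2 * (k : ℝ) + 3) * τr * κ₁)) + c₁ * ((8 * ((k : ℝ) + 2) +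
      14) * (8 * (n : ℝ) + 14)) * ((8 * zb) * (8 * ((k : ℝ) + 2) + 14) * (16 * (k : ℝ) + 36) * (16 * ((k : ℝ) + 2) + 20) * (24 * ((k : ℝ) + 2) + 18)
      * (24 * (n : ℝ) + 18) * (8 * (k : ℝ) + 14)) * ((4 * (n : ℝ) * (4 * (n : ℝ) + 2) * (8 * (k : ℝ) + 22) - 4 * ((k : ℝ) + 2) * (4 * (k : ℝ) + 10) *
      (16 * (n : ℝ) + 20)) * τr * (-(4 * ((n : ℝ) + 2) * ((n : ℝ) + 1) * g₂)) * κ₁) + 96 * c₀ * (8 * ((k : ℝ) + 2) + 14) * ((k : ℝ) + 4) * g₁ * (n :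
      ℝ) * ((n : ℝ) - 1) * (2 * (n : ℝ) - 1) * τr * (-(4 * ((n : ℝ) + 2) * ((n : ℝ) + 1) * g₂)) * (u * (8 * zb) * (8 * ((k : ℝ) + 2) + 14) * (8 * (n
      : ℝ) + 14) * (8 * (k : ℝ) + 22) * (16 * (k : ℝ) + 36) * (16 * ((k : ℝ) + 2) + 20) * (24 * ((k : ℝ) + 2) + 18) * (8 * (k : ℝ) + 14)) + c₀ * (8 *
      (n : ℝ) + 14) * ((n : ℝ) + 2) * g₂ * (u * (8 * zb) * (8 * ((k : ℝ) + 2) + 14) * (8 * (n : ℝ) + 14) * (8 * (k : ℝ) + 22) * (16 * (k : ℝ) + 36) *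
      (16 * (n : ℝ) + 20) * (24 * (n : ℝ) + 18) * (8 * (k : ℝ) + 14)) * (-(96 * ((k : ℝ) + 2) * ((k : ℝ) + 1) * (2 * (k : ℝ) + 3) * τr * (-(4 * (((k
      : ℝ) + 2) + 2) * (((k : ℝ) + 2) + 1) * g₁)))) + c₀ * ((8 * ((k : ℝ) + 2) + 14) * (8 * (n : ℝ) + 14)) * (u * (8 * zb) * (8 * (k : ℝ) + 22) * (16
      * (k : ℝ) + 36) * (24 * ((k : ℝ) + 2) + 18) * (24 * (n : ℝ) + 18) * (8 * (k : ℝ) + 14)) * (-(4 * (((k : ℝ) + 2) + 2) * (((k : ℝ) + 2) + 1) *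
      g₁)) * (-(4 * ((n : ℝ) + 2) * ((n : ℝ) + 1) * g₂)) * ((4 * (n : ℝ) * (4 * (n : ℝ) + 2) * (16 * ((k : ℝ) + 2) + 20) - 4 * ((k : ℝ) + 2) * (4 *
      (k : ℝ) + 10) * (16 * (n : ℝ) + 20)) * τr) + (((8 * ((k : ℝ) + 2) + 14) * (8 * (n : ℝ) + 14)) * cb * u * (8 * ((k : ℝ) + 2) + 14) * (8 * (n :
      ℝ) + 14) * (8 * (k : ℝ) + 22) * (16 * (k : ℝ) + 36) * (16 * ((k : ℝ) + 2) + 20) * (16 * (n : ℝ) + 20) * (24 * ((k : ℝ) + 2) + 18) * (24 * (n :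
      ℝ) + 18) * (g₂ * ((n : ℝ) + 2))) * (32 * ((k : ℝ) + 1) * τr * KM + 16 * ((k : ℝ) + 2) * ((k : ℝ) + 1) * γ) + (((8 * ((k : ℝ) + 2) + 14) * (8 *
      (n : ℝ) + 14)) * cb * u * (8 * ((k : ℝ) + 2) + 14) * (8 * (k : ℝ) + 22) * (16 * (k : ℝ) + 36) * (16 * ((k : ℝ) + 2) + 20) * (16 * (n : ℝ) + 20)
      * (24 * ((k : ℝ) + 2) + 18) * (24 * (n : ℝ) + 18) * (8 * (k : ℝ) + 14)) * (-(4 * ((n : ℝ) + 2) * ((n : ℝ) + 1) * g₂)) * (4 * ((k : ℝ) + 2) * γ)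
      + (((8 * ((k : ℝ) + 2) + 14) * (8 * (n : ℝ) + 14)) * (8 * zb) * (8 * (n : ℝ) + 14) * (16 * (k : ℝ) + 36) * (16 * ((k : ℝ) + 2) + 20) * (16 * (n
      : ℝ) + 20) * (24 * ((k : ℝ) + 2) + 18) * (24 * (n : ℝ) + 18) * (8 * (k : ℝ) + 14)) * Ze * (16 * ((k : ℝ) + 4) * ((k : ℝ) + 3) * ((k : ℝ) + 2) *
      (8 * ((k : ℝ) + 2) + 14) * g₁ * κ₀ + 4 * ((k : ℝ) + 3) * (8 * (k : ℝ) + 22) * (-(4 * (((k : ℝ) + 2) + 2) * (((k : ℝ) + 2) + 1) * g₁)) * κ₀) - 8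
      * ((8 * ((k : ℝ) + 2) + 14) * (8 * (n : ℝ) + 14)) * u * ((8 * ((k : ℝ) + 2) + 14) * (8 * (n : ℝ) + 14) * (8 * (k : ℝ) + 22) * (16 * (k : ℝ) +
      36) * (16 * ((k : ℝ) + 2) + 20) * (16 * (n : ℝ) + 20) * (24 * ((k : ℝ) + 2) + 18) * (24 * (n : ℝ) + 18) * (8 * (k : ℝ) + 14)) * g₁ * ((k : ℝ) +
      4) * zW * Ze₂ - 4 * ((k : ℝ) + 4) * κ₁ * g₁ * ((8 * ((k : ℝ) + 2) + 14) * (8 * (n : ℝ) + 14)) * (8 * zb) * ((8 * ((k : ℝ) + 2) + 14) * (8 * (n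
      : ℝ) + 14) * (8 * (k : ℝ) + 22) * (16 * (k : ℝ) + 36) * (16 * ((k : ℝ) + 2) + 20) * (16 * (n : ℝ) + 20) * (24 * ((k : ℝ) + 2) + 18) * (24 * (n
      : ℝ) + 18) * (8 * (k : ℝ) + 14)) * Ze₃ := ⟨_, rfl⟩
  obtain ⟨z6, hz6⟩ : ∃ z6 : ℝ, z6 = u * (8 * zb) * ((8 * ((k : ℝ) + 2) + 14) * (8 * (n : ℝ) + 14) * (8 * (k : ℝ) + 22) * (16 * (k : ℝ) + 36) * (16 * ((k : ℝ) + 2) + 20) * (16 * (n : ℝ) + 20) * (24 * ((k : ℝ) + 2) + 18) * (24 * (n : ℝ) + 18) * (8 * (k : ℝ) + 14)) * ((8 * ((k : ℝ) + 2) + 14) * (8 * (n : ℝ) + 14)) * c₆ * (g₂ * ((n : ℝ) + 2)) := ⟨_, rfl⟩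
  -- ★ the closed form of the `M²`-slot coefficient (`…FourthDigitK22`): `K₂₂ ≠ 0`
  have hK220 : K22 ≠ 0 := by
    rw [hK22]; exact fourthDigit_K22_ne_zero hmn hg₁0 hg₂0 hc₀0 hc₁0 hcb0 hu0 hu hκ₁ hKM hzb
  -- the scalars with `C` pushed through
  have hK22' := congrArg (fun x : ℝ => (C x : Zonal.RPoly)) hK22
  have hZ1' := congrArg (fun x : ℝ => (C x : Zonal.RPoly)) hZ1
  have hZ2' := congrArg (fun x : ℝ => (C x : Zonal.RPoly)) hZ2
  have hz6' := congrArg (fun x : ℝ => (C x : Zonal.RPoly)) hz6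
  rw [hτr] at hZ2'
  simp only [map_mul, map_add, map_sub, map_neg, map_natCast, map_ofNat, map_one, Nat.cast_add, Nat.cast_ofNat, Nat.cast_one] at hK22' hZ1'
  simp only [map_mul, map_add, map_sub, map_neg, map_natCast, map_ofNat, map_one, Nat.cast_add, Nat.cast_ofNat, Nat.cast_one] at hZ2' hz6'
  have hzb' := congrArg (fun x : ℝ => (C x : Zonal.RPoly)) hzb
  simp only [map_mul, map_add, map_sub, map_neg, map_natCast, map_ofNat, map_one, Nat.cast_add, Nat.cast_ofNat, Nat.cast_one] at hzb'
  -- the nine recurring scalar factors as OPAQUE atoms (keeps the digit-4 `linear_combination` small)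
  obtain ⟨q1r, hq1r⟩ : ∃ x : ℝ, x = 8 * ((k : ℝ) + 2) + 14 := ⟨_, rfl⟩
  obtain ⟨q2r, hq2r⟩ : ∃ x : ℝ, x = 8 * (n : ℝ) + 14 := ⟨_, rfl⟩
  obtain ⟨d1r, hd1r⟩ : ∃ x : ℝ, x = 8 * (k : ℝ) + 22 := ⟨_, rfl⟩
  obtain ⟨d2r, hd2r⟩ : ∃ x : ℝ, x = 16 * (k : ℝ) + 36 := ⟨_, rfl⟩
  obtain ⟨f1r, hf1r⟩ : ∃ x : ℝ, x = 16 * ((k : ℝ) + 2) + 20 := ⟨_, rfl⟩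
  obtain ⟨f2r, hf2r⟩ : ∃ x : ℝ, x = 16 * (n : ℝ) + 20 := ⟨_, rfl⟩
  obtain ⟨h1r, hh1r⟩ : ∃ x : ℝ, x = 24 * ((k : ℝ) + 2) + 18 := ⟨_, rfl⟩
  obtain ⟨h2r, hh2r⟩ : ∃ x : ℝ, x = 24 * (n : ℝ) + 18 := ⟨_, rfl⟩
  obtain ⟨pbr, hpbr⟩ : ∃ x : ℝ, x = 8 * (k : ℝ) + 14 := ⟨_, rfl⟩
  have cq1 : (8 * ((k : Zonal.RPoly) + 2) + 14) = C q1r := by rw [hq1r]; simp only [map_add, map_mul, map_ofNat, map_natCast]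
  have cq1' : (8 * (k : Zonal.RPoly) + 30) = C q1r := by rw [hq1r]; simp only [map_add, map_mul, map_ofNat, map_natCast]; ring
  have cq2 : (8 * (n : Zonal.RPoly) + 14) = C q2r := by rw [hq2r]; simp only [map_add, map_mul, map_ofNat, map_natCast]
  have cd1 : (8 * (k : Zonal.RPoly) + 22) = C d1r := by rw [hd1r]; simp only [map_add, map_mul, map_ofNat, map_natCast]
  have cd1' : (8 * ((k : Zonal.RPoly) + 2) + 6) = C d1r := by rw [hd1r]; simp only [map_add, map_mul, map_ofNat, map_natCast]; ring
  have cd2 : (16 * (k : Zonal.RPoly) + 36) = C d2r := by rw [hd2r]; simp only [map_add, map_mul, map_ofNat, map_natCast]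
  have cf1 : (16 * ((k : Zonal.RPoly) + 2) + 20) = C f1r := by rw [hf1r]; simp only [map_add, map_mul, map_ofNat, map_natCast]
  have cf2 : (16 * (n : Zonal.RPoly) + 20) = C f2r := by rw [hf2r]; simp only [map_add, map_mul, map_ofNat, map_natCast]
  have ch1 : (24 * ((k : Zonal.RPoly) + 2) + 18) = C h1r := by rw [hh1r]; simp only [map_add, map_mul, map_ofNat, map_natCast]
  have ch2 : (24 * (n : Zonal.RPoly) + 18) = C h2r := by rw [hh2r]; simp only [map_add, map_mul, map_ofNat, map_natCast]
  have cpb : (8 * (k : Zonal.RPoly) + 14) = C pbr := by rw [hpbr]; simp only [map_add, map_mul, map_ofNat, map_natCast]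
  -- ★ THE FOURTH DIGIT
  have hE4 : ∃ J' : Zonal.RPoly, Zonal.normSq * (C K22 * L ^ (k + n + 3) * M ^ 2 * W + C Z1 * L ^ (k + n + 4) * M * W
      + C Z2 * L ^ (k + n + 5) * W + C z6 * (L ^ (k + n + 4) * Z6)) + Zonal.normSq ^ 2 * J' = 0 := by
    refine ⟨
      (C u * (8 * ((C q1r) * (C q2r) * C cb * C u * (C q2r) * (C d1r) * (C f1r) * (C f2r) * (C g₂ * ((n : Zonal.RPoly) + 2)))) * (C q1r) * (C q2r) * (C f1r) * (C f2r) * (C h1r) * (C h2r) * (C pbr) * L ^ (n + 1)) * I₁ + ((8 * ((C q1r) * (C q2r) * C cb * C u * (C q2r) * (C d1r) * (C f1r) * (C f2r) * (C g₂ * ((n : Zonal.RPoly) + 2)))) * (C q1r) * (C d2r) * (C f1r) * (C h1r) * (C h2r) * (C pbr) * L * C c₁ * ((C q1r) * (C q2r))) * I₂ + (-(C u * (8 * ((C q1r) * (C q2r) * C cb * C u * (C q2r) * (C d1r) * (C f1r) * (C f2r) * (C g₂ * ((n : Zonal.RPoly)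
      + 2)))) * (C q1r) * (C q2r) * (C d1r) * (C d2r) * (C f1r) * (C h1r) * (C pbr) * C c₀ * ((C q1r) * (((k : Zonal.RPoly) + 2) + 2) * C g₁) * L ^ (k + 3))) * I₃ + (C u * (8 * ((C q1r) * (C q2r) * C cb * C u * (C q2r) * (C d1r) * (C f1r) * (C f2r) * (C g₂ * ((n : Zonal.RPoly) + 2)))) * (C q1r) * (C q2r) * (C d1r) * (C d2r) * (C f2r) * (C h2r) * (C pbr) * C c₀ * ((C q2r) * ((n : Zonal.RPoly) + 2) * C g₂) * L ^ (n + 1)) * I₄ + (C u * (8 * ((C q1r) * (C q2r) * C cb * C u * (C q2r) * (C d1r) * (C f1r) * (C f2r) * (C g₂ * ((n : Zonal.RPoly)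
      + 2)))) * (C d1r) * (C d2r) * (C h1r) * (C h2r) * (C pbr) * L * C c₀ * ((C q1r) * (C q2r))) * I₅ + (C u * (C q1r) * (C q2r) * (C d1r) * (C d2r) * (C f1r) * (C f2r) * (C h1r) * (C h2r) * ((C q1r) * (C q2r)) * C cb * (C g₂ * ((n : Zonal.RPoly) + 2)) * L ^ (n + 3)) * I₆ + (C u * (C q1r) * (C d1r) * (C d2r) * (C f1r) * (C f2r) * (C h1r) * (C h2r) * (C pbr) * L ^ 3 * ((C q1r) * (C q2r)) * C cb) * I₇ + (((8 * ((C q1r) * (C q2r) * C cb * C u * (C q2r) * (C d1r) * (C f1r) * (C f2r) * (C g₂ * ((n : Zonal.RPoly)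
      + 2)))) * (C q2r) * (C d2r) * (C f1r) * (C f2r) * (C h1r) * (C h2r) * (C pbr) * ((C q1r) * (C q2r))) * L ^ 2 * C e₁) * I₈ + ((C u * (8 * ((C q1r) * (C q2r) * C cb * C u * (C q2r) * (C d1r) * (C f1r) * (C f2r) * (C g₂ * ((n : Zonal.RPoly) + 2)))) * ((C q1r) * (C q2r) * (C d1r) * (C d2r) * (C f1r) * (C f2r) * (C h1r) * (C h2r) * (C pbr)) * L ^ 4) * ((C q1r) * (C q2r)) * C c₆) * Zonal.detP P6 G₂ + (C u * ((C q1r) * (C q2r) * (C d1r) * (C d2r) * (C f1r) * (C f2r) * (C h1r) * (C h2r) * (C pbr)) * L ^ 4 * ((C q1r) * (C q2r)) * C e₂) * Zonal.detP Pb' G₁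
      + (C u * ((C q1r) * (C q2r) * (C d1r) * (C d2r) * (C f1r) * (C f2r) * (C h1r) * (C h2r) * (C pbr)) * ((C q1r) * (C q2r)) * C e₂ * (C g₁ * (((k : Zonal.RPoly) + 2) + 2)) * L ^ (k + 7)) * Zonal.detP Gb L + ((8 * ((C q1r) * (C q2r) * C cb * C u * (C q2r) * (C d1r) * (C f1r) * (C f2r) * (C g₂ * ((n : Zonal.RPoly) + 2)))) * ((C q1r) * (C q2r) * (C d1r) * (C d2r) * (C f1r) * (C f2r) * (C h1r) * (C h2r) * (C pbr)) * L ^ 4 * ((C q1r) * (C q2r)) * C e₃) * J₆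
      + (C u * (8 * ((C q1r) * (C q2r) * C cb * C u * (C q2r) * (C d1r) * (C f1r) * (C f2r) * (C g₂ * ((n : Zonal.RPoly) + 2)))) * ((C q1r) * (C q2r) * (C d1r) * (C d2r) * (C f1r) * (C f2r) * (C h1r) * (C h2r) * (C pbr)) * L ^ 4) * ((C q1r) * (C q2r)) * R, ?_⟩
    rw [hK22', hZ1', hZ2', hz6']
    simp only [map_mul, map_add, map_sub, map_neg, map_natCast, map_ofNat, map_one, Nat.cast_add, Nat.cast_ofNat, Nat.cast_one] at hE2 hT6 hX3 hX4
    simp only [map_mul, map_add, map_sub, map_neg, map_natCast, map_ofNat, map_one, Nat.cast_add, Nat.cast_ofNat, Nat.cast_one] at hX1b hX1a hX2 hX6a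
    simp only [map_mul, map_add, map_sub, map_neg, map_natCast, map_ofNat, map_one, Nat.cast_add, Nat.cast_ofNat, Nat.cast_one] at hX6b hX5 hPbD2 hPbD3
    simp only [map_mul, map_add, map_sub, map_neg, map_natCast, map_ofNat, map_one, Nat.cast_add, Nat.cast_ofNat, Nat.cast_one] at hPbL hP6D hT5 hKM'
    simp only [map_mul, map_add, map_sub, map_neg, map_natCast, map_ofNat, map_one, Nat.cast_add, Nat.cast_ofNat, Nat.cast_one] at hzW' heZ₁ heZ₂ heZ₃ hZ6 ⊢
    rw [hzb'] at hPbD2 hPbD3 ⊢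
    simp only [cq1, cq1', cq2, cd1, cd1', cd2, cf1, cf2, ch1, ch2, cpb] at hE2 hT6 hX3 hX4 hX1b hX1a hX2 hX6a hX6b hX5 hPbD2 hPbD3 hPbL hP6D hT5 hKM' hzW' heZ₁ heZ₂ heZ₃ hZ6 ⊢
    clear hK22 hZ1 hZ2 hz6 hKM hzW hzb hzb' hK220 hXbh hXbL h1 h2 hXbchart hJ cq1 cq1' cq2 cd1 cd1' cd2 cf1 cf2 ch1 ch2 cpb hq1r hq2r hd1r hd2r hf1r hf2r hh1r hh2r hpbr
    linear_combination (norm := ring_nf) (C u * (8 * ((C q1r) * (C q2r) * C cb * C u * (C q2r) * (C d1r) * (C f1r) * (C f2r) * (C g₂ * ((n : Zonal.RPoly) + 2)))) * ((C q1r) * (C q2r) * (C d1r) * (C d2r) * (C f1r) * (C f2r) * (C h1r) * (C h2r) * (C pbr)) * L ^ 4) * hE2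
      - (C u * (8 * ((C q1r) * (C q2r) * C cb * C u * (C q2r) * (C d1r) * (C f1r) * (C f2r) * (C g₂ * ((n : Zonal.RPoly) + 2)))) * (C q1r) * (C q2r) * (C f1r) * (C f2r) * (C h1r) * (C h2r) * (C pbr) * L ^ (n + 1)) * hX3
      - ((8 * ((C q1r) * (C q2r) * C cb * C u * (C q2r) * (C d1r) * (C f1r) * (C f2r) * (C g₂ * ((n : Zonal.RPoly) + 2)))) * (C q1r) * (C d2r) * (C f1r) * (C h1r) * (C h2r) * (C pbr) * L * C c₁ * ((C q1r) * (C q2r))) * hX4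
      - (-(C u * (8 * ((C q1r) * (C q2r) * C cb * C u * (C q2r) * (C d1r) * (C f1r) * (C f2r) * (C g₂ * ((n : Zonal.RPoly) + 2)))) * (C q1r) * (C q2r) * (C d1r) * (C d2r) * (C f1r) * (C h1r) * (C pbr) * C c₀ * ((C q1r) * (((k : Zonal.RPoly) + 2) + 2) * C g₁) * L ^ (k + 3))) * hX1b
      - (C u * (8 * ((C q1r) * (C q2r) * C cb * C u * (C q2r) * (C d1r) * (C f1r) * (C f2r) * (C g₂ * ((n : Zonal.RPoly) + 2)))) * (C q1r) * (C q2r) * (C d1r) * (C d2r) * (C f2r) * (C h2r) * (C pbr) * C c₀ * ((C q2r) * ((n : Zonal.RPoly) + 2) * C g₂) * L ^ (n + 1)) * hX1a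
      - (C u * (8 * ((C q1r) * (C q2r) * C cb * C u * (C q2r) * (C d1r) * (C f1r) * (C f2r) * (C g₂ * ((n : Zonal.RPoly) + 2)))) * (C d1r) * (C d2r) * (C h1r) * (C h2r) * (C pbr) * L * C c₀ * ((C q1r) * (C q2r))) * hX2
      - (C u * ((C q1r) * (C q2r) * (C d1r) * (C d2r) * (C f1r) * (C f2r) * (C h1r) * (C h2r) * (C pbr)) * L ^ 4 * ((C q1r) * (C q2r)) * C cb) * hPbD2
      - ((C u * ((C q1r) * (C q2r) * (C d1r) * (C d2r) * (C f1r) * (C f2r) * (C h1r) * (C h2r) * (C pbr)) * ((C q1r) * (C q2r)) * C cb * (C g₂ * ((n : Zonal.RPoly) + 2)) * L ^ (n + 5)) + (C u * ((C q1r) * (C q2r) * (C d1r) * (C d2r) * (C f1r) * (C f2r) * (C h1r) * (C h2r) * (C pbr)) * ((C q1r) * (C q2r)) * C e₂ * (C g₁ * (((k : Zonal.RPoly) + 2) + 2)) * Zonal.normSq * L ^ (k + 7))) * hPbL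
      - (Zonal.normSq * (C u * (C q1r) * (C q2r) * (C d1r) * (C d2r) * (C f1r) * (C f2r) * (C h1r) * (C h2r) * ((C q1r) * (C q2r)) * C cb * (C g₂ * ((n : Zonal.RPoly) + 2)) * L ^ (n + 3))) * hX6a
      - (Zonal.normSq * (C u * (C q1r) * (C d1r) * (C d2r) * (C f1r) * (C f2r) * (C h1r) * (C h2r) * (C pbr) * L ^ 3 * ((C q1r) * (C q2r)) * C cb)) * hX6b
      - (((8 * ((C q1r) * (C q2r) * C cb * C u * (C q2r) * (C d1r) * (C f1r) * (C f2r) * (C g₂ * ((n : Zonal.RPoly) + 2)))) * (C q2r) * (C d2r) * (C f1r) * (C f2r) * (C h1r) * (C h2r) * (C pbr) * ((C q1r) * (C q2r))) * L ^ 2 * C e₁) * hX5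
      - ((C u * (8 * ((C q1r) * (C q2r) * C cb * C u * (C q2r) * (C d1r) * (C f1r) * (C f2r) * (C g₂ * ((n : Zonal.RPoly) + 2)))) * ((C q1r) * (C q2r) * (C d1r) * (C d2r) * (C f1r) * (C f2r) * (C h1r) * (C h2r) * (C pbr)) * L ^ 4) * Zonal.normSq * ((C q1r) * (C q2r))) * hT6
      - ((C u * (8 * ((C q1r) * (C q2r) * C cb * C u * (C q2r) * (C d1r) * (C f1r) * (C f2r) * (C g₂ * ((n : Zonal.RPoly) + 2)))) * ((C q1r) * (C q2r) * (C d1r) * (C d2r) * (C f1r) * (C f2r) * (C h1r) * (C h2r) * (C pbr)) * L ^ 4) * Zonal.normSq * ((C q1r) * (C q2r)) * C c₆) * hP6D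
      - (Zonal.normSq * C u * (8 * ((C q1r) * (C q2r) * C cb * C u * (C q2r) * (C d1r) * (C f1r) * (C f2r) * (C g₂ * ((n : Zonal.RPoly) + 2)))) * ((C q1r) * (C q2r) * (C d1r) * (C d2r) * (C f1r) * (C f2r) * (C h1r) * (C h2r) * (C pbr)) * ((C q1r) * (C q2r)) * C c₆ * (C g₂ * ((n : Zonal.RPoly) + 2))) * hZ6
      - (C u * ((C q1r) * (C q2r) * (C d1r) * (C d2r) * (C f1r) * (C f2r) * (C h1r) * (C h2r) * (C pbr)) * L ^ 4 * Zonal.normSq * ((C q1r) * (C q2r)) * C e₂) * hPbD3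
      - ((8 * ((C q1r) * (C q2r) * C cb * C u * (C q2r) * (C d1r) * (C f1r) * (C f2r) * (C g₂ * ((n : Zonal.RPoly) + 2)))) * ((C q1r) * (C q2r) * (C d1r) * (C d2r) * (C f1r) * (C f2r) * (C h1r) * (C h2r) * (C pbr)) * L ^ 4 * Zonal.normSq * ((C q1r) * (C q2r)) * C e₃) * hT5
      - (((8 * ((C q1r) * (C q2r) * C cb * C u * (C q2r) * (C d1r) * (C f1r) * (C f2r) * (C g₂ * ((n : Zonal.RPoly) + 2)))) * (C q2r) * (C d2r) * (C f1r) * (C f2r) * (C h1r) * (C h2r) * (C pbr) * ((C q1r) * (C q2r))) * (-(4 * ((k : Zonal.RPoly) + 4) * (C q1r) * (C d1r) * C κ₁ * C g₁) * L ^ 2 * W + Zonal.normSq * (((C q1r) * C g₁ * ((k : Zonal.RPoly) + 4)) * (16 * ((k : Zonal.RPoly) + 3) * ((k : Zonal.RPoly) + 2) * C κ₀) * L * W + (4 * ((k : Zonal.RPoly) + 3) * (C d1r) * (-(4 * (((k : Zonal.RPoly) + 2) + 2) * (((k : Zonal.RPoly) + 2) + 1) * C g₁)) * C κ₀) * L *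 W + ((C q1r) * C g₁ * ((k : Zonal.RPoly) + 4)) * (32 * ((k : Zonal.RPoly) + 2) * ((k : Zonal.RPoly) + 1) * C κ₁) * M * W))) * heZ₁
      - (C u * ((C q1r) * (C q2r) * (C d1r) * (C d2r) * (C f1r) * (C f2r) * (C h1r) * (C h2r) * (C pbr)) * ((C q1r) * (C q2r)) * (C g₁ * (((k : Zonal.RPoly) + 2) + 2)) * Zonal.normSq * (-(8 * C KM) * M * W - 4 * (2 * C zW) * L * W)) * heZ₂
      - ((8 * ((C q1r) * (C q2r) * C cb * C u * (C q2r) * (C d1r) * (C f1r) * (C f2r) * (C g₂ * ((n : Zonal.RPoly) + 2)))) * ((C q1r) * (C q2r) * (C d1r) * (C d2r) * (C f1r) * (C f2r) * (C h1r) * (C h2r) * (C pbr)) * Zonal.normSq * ((C q1r) * (C q2r)) * (-(4 * (((k : Zonal.RPoly) + 2) + 2) * C κ₁ * C g₁)) * W) * heZ₃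
      - ((C u * ((C q1r) * (C q2r) * (C d1r) * (C d2r) * (C f1r) * (C f2r) * (C h1r) * (C h2r) * (C pbr)) * ((C q1r) * (C q2r)) * C cb * (C g₂ * ((n : Zonal.RPoly) + 2)) * L ^ (n + 5)) * (-(8 * L ^ k * M * W))) * hKM'
      - ((C u * ((C q1r) * (C q2r) * (C d1r) * (C d2r) * (C f1r) * (C f2r) * (C h1r) * (C h2r) * (C pbr)) * ((C q1r) * (C q2r)) * C cb * (C g₂ * ((n : Zonal.RPoly) + 2)) * L ^ (n + 5)) * (-(4 * (2 * L ^ (k + 1) * W)))) * hzW'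
  obtain ⟨J', hJ'⟩ := hE4
  have hE4' : C K22 * L ^ (k + n + 3) * M ^ 2 * W + L ^ (k + n + 4) * (C Z1 * M * W + C Z2 * L * W + C z6 * Z6)
      + Zonal.normSq * J' = 0 := by
    have h3 : Zonal.normSq * (C K22 * L ^ (k + n + 3) * M ^ 2 * W + L ^ (k + n + 4) * (C Z1 * M * W + C Z2 * L * W + C z6 * Z6)
        + Zonal.normSq * J') = 0 := by linear_combination hJ'
    exact (mul_eq_zero.mp h3).resolve_left Zonal.rho_ne_zero
  -- (8) the chart: `chartT L ∣ K₂₂ · chartT W · (chartT M)²`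
  by_contra hW0
  have h4 := congrArg (fun p : Zonal.RPoly => Zonal.chartT (map (algebraMap ℝ ℂ) p)) hE4'
  simp only [map_add, map_mul, map_pow, Zonal.map_normSq, Zonal.chartT_add, Zonal.chartT_mul, Zonal.chartT_pow, Zonal.chartT_normSq,
    zero_mul, add_zero, map_zero, Zonal.chartT_zero, map_C, Zonal.chartT_C] at h4
  have h5 : Zonal.chartT (map (algebraMap ℝ ℂ) L) ^ (k + n + 3) * (Polynomial.C ((algebraMap ℝ ℂ) K22) * (Zonal.chartT (map (algebraMap ℝ ℂ) W) * Zonal.chartT (map (algebraMap ℝ ℂ) M) ^ 2)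
      + Zonal.chartT (map (algebraMap ℝ ℂ) L) * (Polynomial.C ((algebraMap ℝ ℂ) Z1) * Zonal.chartT (map (algebraMap ℝ ℂ) M) * Zonal.chartT (map (algebraMap ℝ ℂ) W) + Polynomial.C ((algebraMap ℝ ℂ) Z2) * Zonal.chartT (map (algebraMap ℝ ℂ) L) * Zonal.chartT (map (algebraMap ℝ ℂ) W) + Polynomial.C ((algebraMap ℝ ℂ) z6) * Zonal.chartT (map (algebraMap ℝ ℂ) Z6))) = 0 := by
    linear_combination h4
  have h6 := (mul_eq_zero.mp h5).resolve_left (pow_ne_zero _ hLc)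
  have hdvd : Zonal.chartT (map (algebraMap ℝ ℂ) (Zonal.genL ra rb rd re rf))
      ∣ Polynomial.C ((algebraMap ℝ ℂ) K22) * (Zonal.chartT (map (algebraMap ℝ ℂ) (Zonal.genW ra rb rd re rf))
        * Zonal.chartT (map (algebraMap ℝ ℂ) (Zonal.genM ra rb rd re rf)) ^ 2) :=
    ⟨-(Polynomial.C ((algebraMap ℝ ℂ) Z1) * Zonal.chartT (map (algebraMap ℝ ℂ) M) * Zonal.chartT (map (algebraMap ℝ ℂ) W) + Polynomial.C ((algebraMap ℝ ℂ) Z2) * Zonal.chartT (map (algebraMap ℝ ℂ) L) * Zonal.chartT (map (algebraMap ℝ ℂ) W) + Polynomial.C ((algebraMap ℝ ℂ) z6) * Zonal.chartT (map (algebraMap ℝ ℂ) Z6)),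
      by rw [← hLdef, ← hMdef, ← hWdef]; linear_combination h6⟩
  have hk := Zonal.eq_zero_of_chartT_genL_dvd_sq ra rb rd re rf hW0 hdvd
  exact hK220 (by simpa using hk)

end Exit

end Summit.NavierStokesRegularity.NavierStokesRegularity.Theorems.PoloidalLiouville.HorizonTower

end
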